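import Literature.MathematicalPhysics.QuantumFieldTheory.Balaban1983to89.Node00.Record11
import Literature.MathematicalPhysics.QuantumFieldTheory.Balaban1983to89.BlockAveragingExpMeanLogContinuous

/-!
# DAG node N11 — DEFINITIONS: THE OPEN-LOCUS TRUNCATION OF A COMPLEX FUNCTION (`truncC`), AND WHY IT KEEPS (2.27)(i) LOCALITY AND (2.27)(iii) GAUGE
# INVARIANCE — door (d4), part 1 of 2

HEADER — WORK-UNIT METADATA.  Cell `pub-ymgap`, YM-PLAN Track A (HUMAN RULING D-0062), seat `pub-ymgap-dag-n11-d` (g11; R134 fan-out seat N11 [B14], strategy s2),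
route `BalabanUVNodes`, item K1⁷ `StabilityBAtRecordR13SepCoPH` = stmt-QuantumFields-20542; DEFINITION lane (`--kind definition --supports 20542 --as helper`),
count-neutral.  [III] = [Balaban1988Convergent], [I] = [Balaban1987RG1].  Over 11b (`Node00.Sect2FrameOfRecord`: `Sect2.CPair`, `Sect2.cAct`, `Sect2.agreeOnSet`,
`Sect2.ofBackgroundC`) and 11d's model of record (`Node00.Record11`: `MatA`, `ιSU`).

WHY THIS FILE.  This seat's p586165 `…N11NoExpansionStepSpecificationOfTermRows` specifies the no-expansion 𝐓-step at a generic Stage-13 parameter with six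
rows on the §2 WITNESS's term values (`𝐄∕𝐑∕𝐁` measurable, resp. uniformly bounded, read at the embedded background).  The witness is ∃-bound, so such rows
can only ever be discharged from the LAWS the witness carries (g9 NOTE of record).  Door (d4): r11's laws say the terms are ANALYTIC on the spaces of
record ((2.27)(ii), (2.30), (2.41)(ii)) and BOUNDED there ((2.27)(iv), (2.31), (2.42)); analytic ⇒ continuous ⇒ Borel on the (open) analyticity locus.
This file is the function-level tool: the truncation of `f : Φ → ℂ` to the open set where it is analytic and strictly below a threshold; part 2
(`…N11SpaceTruncationDefs`) applies it to §2 term values and transports r11's law packages.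

WHAT THIS FILE DECLARES (definitions + elementary complex analysis, 0 `sorry`).
* §1 `truncLocus c f`, `truncC c f`; `isOpen_truncLocus` (Mathlib `isOpen_analyticAt` + continuity on the locus), `truncC_of_mem ∕ _of_not_mem`,
  `norm_truncC_le`, `analyticAt_truncC` (agrees with `f` near every point of the locus), ★ `measurable_truncC_comp` ∕ `measurable_re_truncC_comp` (Borel
  along any continuous map from a space whose open sets are measurable — `ContinuousOn.measurable_piecewise`).
* §2 the `X`-gluing map `glueOn Y ψ` on `Sect2.CPair` (`agreeOnSet_glueOn`, `glueOn_eq_of_agreeOnSet`, `analyticAt_glueOn`) and ★ `analyticAt_iff_of_agreeOnSet`: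
  a function reading the configuration only through the bonds of `Y` ((2.27)(i)) has a `Y`-local analyticity locus; `truncC_congr_of_agreeOnSet`.
* §3 `cAct_inv_cAct` ∕ `cAct_cAct_inv` ((1.10) is undone by the inverse), `coe_inv_gauge`, `analyticAt_cAct` ((1.10) is analytic) and
  ★ `analyticAt_cAct_iff_of_invariant`: a gauge-invariant function ((2.27)(iii)) has a gauge-invariant locus; `truncC_cAct_of_invariant`.
* §4 `continuous_ofBackgroundC_ιSU`: the record's embedding `U ↦ (ιU, 0)` of `SU(N)`-valued configurations into `Φ = (M_N(ℂ)^{bonds})²` is continuous.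

HONEST FRAMING.  Helper lane of K1⁷; elementary complex analysis on a normed `ℂ`-space and bookkeeping of (1.10) ∕ (2.27)(i),(iii); nothing of Bałaban's is
asserted.  N11 NOT discharged; K1⁷ NOT closed; counts unmoved (typed 28∕28 · discharged 5∕27).  One finite four-torus programme at fixed `ε = L^{−K}` — NOT ℝ⁴,
NOT OS, NOT a mass gap, NOT Clay.  No `sorry`, `axiom`, `instance`, `notation`.  Sources (SHAPE only): [III] (2.27) p.259; [I] (1.9)–(1.10) p.262, pp.251–252.
-/

noncomputable section

open MeasureTheory Set Filter Topology
open scoped BigOperators Matrix.Norms.L2Operator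

namespace Summit.QuantumFields.YangMills.Theorems.BalabanUVNodesN11OpenLocusTruncationDefs

open Literature.MathematicalPhysics.QuantumFieldTheory.Balaban1983to89 T4Continuum Node00

/-! ## §1  The open-locus truncation of a complex function -/

section TruncC

variable {Φ : Type*} [NormedAddCommGroup Φ] [NormedSpace ℂ Φ]

/-- The TRUNCATION LOCUS of `f` at threshold `c`: the points where `f` is analytic and `‖f‖ < c` (an open set, `isOpen_truncLocus`).
[cite: Balaban1988Convergent, (2.27)(ii),(iv) p.259 (bookkeeping shape)] -/
def truncLocus (c : ℝ) (f : Φ → ℂ) : Set Φ :=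
  {φ | AnalyticAt ℂ f φ ∧ ‖f φ‖ < c}

open Classical in
/-- **THE OPEN-LOCUS TRUNCATION** `truncC c f`: `f` on its truncation locus, `0` elsewhere. [cite: Balaban1988Convergent, (2.27)(ii),(iv) p.259 (bookkeeping shape)] -/
def truncC (c : ℝ) (f : Φ → ℂ) : Φ → ℂ :=
  fun φ => if φ ∈ truncLocus c f then f φ else 0

/-- Membership in the locus, read off (`Iff.rfl`). [cite: Balaban1988Convergent, (2.27) p.259 (bookkeeping)] -/
theorem mem_truncLocus_iff (c : ℝ) (f : Φ → ℂ) (φ : Φ) : φ ∈ truncLocus c f ↔ AnalyticAt ℂ f φ ∧ ‖f φ‖ < c := Iff.rfl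

/-- `f` is continuous on its analyticity locus. [cite: Balaban1988Convergent, (2.27)(ii) p.259 (bookkeeping)] -/
theorem continuousOn_setOf_analyticAt (f : Φ → ℂ) : ContinuousOn f {φ | AnalyticAt ℂ f φ} :=
  fun _ hφ => hφ.continuousAt.continuousWithinAt

/-- **THE TRUNCATION LOCUS IS OPEN** (the analyticity locus is open, `f` is continuous on it). [cite: Balaban1988Convergent, (2.27)(ii) p.259 (bookkeeping)] -/
theorem isOpen_truncLocus (c : ℝ) (f : Φ → ℂ) : IsOpen (truncLocus c f) := by
  have h : truncLocus c f = {φ | AnalyticAt ℂ f φ} ∩ f ⁻¹' {w : ℂ | ‖w‖ < c} := by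
    ext φ; simp [truncLocus]
  rw [h]
  exact (continuousOn_setOf_analyticAt f).isOpen_inter_preimage (isOpen_analyticAt ℂ f) (isOpen_lt continuous_norm continuous_const)

/-- On the locus the truncation is `f`. [cite: Balaban1988Convergent, (2.27) p.259 (bookkeeping)] -/
theorem truncC_of_mem {c : ℝ} {f : Φ → ℂ} {φ : Φ} (h : φ ∈ truncLocus c f) : truncC c f φ = f φ := by
  classical
  exact if_pos h

/-- Off the locus the truncation is `0`. [cite: Balaban1988Convergent, (2.27) p.259 (bookkeeping)] -/
theorem truncC_of_not_mem {c : ℝ} {f : Φ → ℂ} {φ : Φ} (h : φ ∉ truncLocus c f) : truncC c f φ = 0 := by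
  classical
  exact if_neg h

/-- The truncation as a `Set.piecewise` (for the Borel argument). [cite: Balaban1988Convergent, (2.27) p.259 (bookkeeping)] -/
theorem truncC_eq_piecewise (c : ℝ) (f : Φ → ℂ) [∀ φ, Decidable (φ ∈ truncLocus c f)] : truncC c f = (truncLocus c f).piecewise f 0 := by
  funext φ
  by_cases h : φ ∈ truncLocus c f
  · rw [truncC_of_mem h, Set.piecewise_eq_of_mem _ _ _ h]
  · rw [truncC_of_not_mem h, Set.piecewise_eq_of_notMem _ _ _ h]; rfl

/-- **THE TRUNCATION IS BOUNDED BY THE THRESHOLD** (for a nonnegative threshold). [cite: Balaban1988Convergent, (2.27)(iv) p.259 (bookkeeping)] -/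
theorem norm_truncC_le {c : ℝ} (hc : 0 ≤ c) (f : Φ → ℂ) (φ : Φ) : ‖truncC c f φ‖ ≤ c := by
  by_cases h : φ ∈ truncLocus c f
  · rw [truncC_of_mem h]; exact h.2.le
  · rw [truncC_of_not_mem h, norm_zero]; exact hc

/-- The real part of the truncation is bounded by the threshold. [cite: Balaban1988Convergent, (2.27)(iv) p.259 (bookkeeping)] -/
theorem abs_re_truncC_le {c : ℝ} (hc : 0 ≤ c) (f : Φ → ℂ) (φ : Φ) : |(truncC c f φ).re| ≤ c :=
  (Complex.abs_re_le_norm _).trans (norm_truncC_le hc f φ)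

/-- Near a point of the locus the truncation IS `f`. [cite: Balaban1988Convergent, (2.27)(ii) p.259 (bookkeeping)] -/
theorem truncC_eventuallyEq {c : ℝ} {f : Φ → ℂ} {φ : Φ} (h : φ ∈ truncLocus c f) : truncC c f =ᶠ[𝓝 φ] f :=
  Filter.eventually_of_mem ((isOpen_truncLocus c f).mem_nhds h) fun _ hψ => truncC_of_mem hψ

/-- **THE TRUNCATION IS ANALYTIC AT EVERY POINT OF ITS LOCUS** (it agrees with `f` on an open neighbourhood). [cite: Balaban1988Convergent, (2.27)(ii) p.259 (bookkeeping)] -/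
theorem analyticAt_truncC {c : ℝ} {f : Φ → ℂ} {φ : Φ} (h : φ ∈ truncLocus c f) : AnalyticAt ℂ (truncC c f) φ :=
  h.1.congr (truncC_eventuallyEq h).symm

/-- The truncation is analytic on a neighbourhood of every subset of the locus. [cite: Balaban1988Convergent, (2.27)(ii) p.259 (bookkeeping)] -/
theorem analyticOnNhd_truncC_of_subset {c : ℝ} {f : Φ → ℂ} {s : Set Φ} (hs : s ⊆ truncLocus c f) : AnalyticOnNhd ℂ (truncC c f) s :=
  fun _ hφ => analyticAt_truncC (hs hφ)

/-- A set on which `f` is analytic (on a neighbourhood) and strictly below the threshold lies in the locus. [cite: Balaban1988Convergent, (2.27)(ii),(iv) p.259 (bookkeeping)] -/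
theorem subset_truncLocus_of {c : ℝ} {f : Φ → ℂ} {s : Set Φ} (ha : AnalyticOnNhd ℂ f s) (hb : ∀ φ ∈ s, ‖f φ‖ < c) : s ⊆ truncLocus c f :=
  fun φ hφ => ⟨ha φ hφ, hb φ hφ⟩

/-- `f` is continuous on the locus. [cite: Balaban1988Convergent, (2.27)(ii) p.259 (bookkeeping)] -/
theorem continuousOn_truncLocus (c : ℝ) (f : Φ → ℂ) : ContinuousOn f (truncLocus c f) :=
  (continuousOn_setOf_analyticAt f).mono fun _ h => h.1

/-- **★ THE TRUNCATION IS BOREL ALONG ANY CONTINUOUS MAP**: for a continuous `g : X → Φ` from a topological space whose open sets are measurable,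
`x ↦ truncC c f (g x)` is measurable (continuous on the open preimage of the locus, zero off it). [cite: Balaban1988Convergent, (2.27)(ii) p.259 (bookkeeping)] -/
theorem measurable_truncC_comp {X : Type*} [TopologicalSpace X] [MeasurableSpace X] [OpensMeasurableSpace X] (c : ℝ) (f : Φ → ℂ) {g : X → Φ}
    (hg : Continuous g) : Measurable (fun x => truncC c f (g x)) := by
  classical
  have hset : IsOpen (g ⁻¹' truncLocus c f) := (isOpen_truncLocus c f).preimage hg
  have h1 : (fun x => truncC c f (g x)) = (g ⁻¹' truncLocus c f).piecewise (f ∘ g) 0 := by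
    funext x
    by_cases hx : x ∈ g ⁻¹' truncLocus c f
    · rw [Set.piecewise_eq_of_mem _ _ _ hx]; exact truncC_of_mem hx
    · rw [Set.piecewise_eq_of_notMem _ _ _ hx]; exact truncC_of_not_mem hx
  rw [h1]
  exact ContinuousOn.measurable_piecewise ((continuousOn_truncLocus c f).comp hg.continuousOn fun _ hx => hx) continuousOn_const
    hset.measurableSet

/-- The real part along a continuous map is measurable. [cite: Balaban1988Convergent, (2.27)(ii) p.259 (bookkeeping)] -/
theorem measurable_re_truncC_comp {X : Type*} [TopologicalSpace X] [MeasurableSpace X] [OpensMeasurableSpace X] (c : ℝ) (f : Φ → ℂ) {g : X → Φ}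
    (hg : Continuous g) : Measurable (fun x => (truncC c f (g x)).re) :=
  Complex.measurable_re.comp (measurable_truncC_comp c f hg)

/-- If `f = f'` then the truncations agree (congruence in the function). [cite: Balaban1988Convergent, (2.27) p.259 (bookkeeping)] -/
theorem truncC_congr_fun {c : ℝ} {f f' : Φ → ℂ} (h : f = f') : truncC c f = truncC c f' := by rw [h]

end TruncC

/-! ## §2  Locality ((2.27)(i)) passes to the analyticity locus: the `X`-gluing map -/

section Glue

variable {P : Params} {𝔸 : Type*}

open Classical in
/-- **THE `X`-GLUING MAP**: `glueOn Y ψ φ` takes `φ` on the bonds with both endpoints in `Y` and `ψ` elsewhere (both components).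
[cite: Balaban1988Convergent, (2.27)(i) p.259 (bookkeeping shape)] -/
def glueOn (Y : Set (Site P 0)) (ψ φ : Sect2.CPair P 𝔸) : Sect2.CPair P 𝔸 :=
  (fun b => if b.src ∈ Y ∧ b.tgt ∈ Y then φ.1 b else ψ.1 b, fun b => if b.src ∈ Y ∧ b.tgt ∈ Y then φ.2 b else ψ.2 b)

/-- The glued configuration agrees with `φ` on `Y`. [cite: Balaban1988Convergent, (2.27)(i) p.259 (bookkeeping)] -/
theorem agreeOnSet_glueOn (Y : Set (Site P 0)) (ψ φ : Sect2.CPair P 𝔸) : Sect2.agreeOnSet Y (glueOn Y ψ φ) φ := by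
  classical
  intro b h1 h2
  simp only [glueOn, h1, h2, and_self, if_true]

/-- If `φ` agrees with `ψ` on `Y`, gluing `φ` into `ψ` returns `ψ`. [cite: Balaban1988Convergent, (2.27)(i) p.259 (bookkeeping)] -/
theorem glueOn_eq_of_agreeOnSet {Y : Set (Site P 0)} {φ ψ : Sect2.CPair P 𝔸} (h : Sect2.agreeOnSet Y φ ψ) : glueOn Y ψ φ = ψ := by
  classical
  refine Prod.ext (funext fun b => ?_) (funext fun b => ?_)
  · show (if b.src ∈ Y ∧ b.tgt ∈ Y then φ.1 b else ψ.1 b) = ψ.1 b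
    split_ifs with hb
    · exact (h b hb.1 hb.2).1
    · rfl
  · show (if b.src ∈ Y ∧ b.tgt ∈ Y then φ.2 b else ψ.2 b) = ψ.2 b
    split_ifs with hb
    · exact (h b hb.1 hb.2).2
    · rfl

/-- A `Y`-local function is invariant under gluing into any configuration. [cite: Balaban1988Convergent, (2.27)(i) p.259 (bookkeeping)] -/
theorem comp_glueOn_eq_of_local {Y : Set (Site P 0)} {f : Sect2.CPair P 𝔸 → ℂ} (hloc : ∀ φ ψ, Sect2.agreeOnSet Y φ ψ → f φ = f ψ)
    (ψ : Sect2.CPair P 𝔸) : f ∘ glueOn Y ψ = f :=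
  funext fun φ => hloc _ _ (agreeOnSet_glueOn Y ψ φ)

variable [NormedRing 𝔸] [NormedAlgebra ℂ 𝔸]

/-- The evaluation of the first component at a bond is analytic (a continuous linear map). [cite: Balaban1987RG1, (1.9) p.262 (bookkeeping)] -/
theorem analyticAt_fst_apply (b : PBond P 0) (φ₀ : Sect2.CPair P 𝔸) : AnalyticAt ℂ (fun φ : Sect2.CPair P 𝔸 => φ.1 b) φ₀ :=
  ((ContinuousLinearMap.proj (R := ℂ) b).comp (ContinuousLinearMap.fst ℂ (PBond P 0 → 𝔸) (PBond P 0 → 𝔸))).analyticAt φ₀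

/-- The evaluation of the second component at a bond is analytic. [cite: Balaban1987RG1, (1.9) p.262 (bookkeeping)] -/
theorem analyticAt_snd_apply (b : PBond P 0) (φ₀ : Sect2.CPair P 𝔸) : AnalyticAt ℂ (fun φ : Sect2.CPair P 𝔸 => φ.2 b) φ₀ :=
  ((ContinuousLinearMap.proj (R := ℂ) b).comp (ContinuousLinearMap.snd ℂ (PBond P 0 → 𝔸) (PBond P 0 → 𝔸))).analyticAt φ₀

/-- **THE GLUING MAP IS ANALYTIC** (coordinatewise a coordinate or a constant). [cite: Balaban1988Convergent, (2.27)(i)–(ii) p.259 (bookkeeping)] -/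
theorem analyticAt_glueOn (Y : Set (Site P 0)) (ψ φ₀ : Sect2.CPair P 𝔸) : AnalyticAt ℂ (glueOn Y ψ) φ₀ := by
  classical
  refine AnalyticAt.prod (analyticAt_pi_iff.mpr fun b => ?_) (analyticAt_pi_iff.mpr fun b => ?_)
  · by_cases hb : b.src ∈ Y ∧ b.tgt ∈ Y
    · simp only [hb, and_self, if_true]; exact analyticAt_fst_apply b φ₀
    · simp only [hb, if_false]; exact analyticAt_const
  · by_cases hb : b.src ∈ Y ∧ b.tgt ∈ Y
    · simp only [hb, and_self, if_true]; exact analyticAt_snd_apply b φ₀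
    · simp only [hb, if_false]; exact analyticAt_const

/-- One direction of the locality of the locus. [cite: Balaban1988Convergent, (2.27)(i)–(ii) p.259 (bookkeeping)] -/
theorem analyticAt_of_agreeOnSet {Y : Set (Site P 0)} {f : Sect2.CPair P 𝔸 → ℂ} (hloc : ∀ φ ψ, Sect2.agreeOnSet Y φ ψ → f φ = f ψ)
    {φ ψ : Sect2.CPair P 𝔸} (h : Sect2.agreeOnSet Y φ ψ) (hψ : AnalyticAt ℂ f ψ) : AnalyticAt ℂ f φ := by
  have h1 : glueOn Y ψ φ = ψ := glueOn_eq_of_agreeOnSet h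
  have h2 : AnalyticAt ℂ f (glueOn Y ψ φ) := by rw [h1]; exact hψ
  have h3 : AnalyticAt ℂ (f ∘ glueOn Y ψ) φ := h2.comp (analyticAt_glueOn Y ψ φ)
  rwa [comp_glueOn_eq_of_local hloc] at h3

/-- **★ A `Y`-LOCAL FUNCTION HAS A `Y`-LOCAL ANALYTICITY LOCUS**: if `f` depends on the configuration only through the bonds of `Y` ((2.27)(i)), then
`AnalyticAt ℂ f φ ↔ AnalyticAt ℂ f ψ` whenever `φ, ψ` agree on `Y`. [cite: Balaban1988Convergent, (2.27)(i)–(ii) p.259] -/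
theorem analyticAt_iff_of_agreeOnSet {Y : Set (Site P 0)} {f : Sect2.CPair P 𝔸 → ℂ} (hloc : ∀ φ ψ, Sect2.agreeOnSet Y φ ψ → f φ = f ψ)
    {φ ψ : Sect2.CPair P 𝔸} (h : Sect2.agreeOnSet Y φ ψ) : AnalyticAt ℂ f φ ↔ AnalyticAt ℂ f ψ :=
  ⟨analyticAt_of_agreeOnSet hloc (Sect2.agreeOnSet_symm h), analyticAt_of_agreeOnSet hloc h⟩

/-- A `Y`-local function has a `Y`-local truncation locus. [cite: Balaban1988Convergent, (2.27)(i) p.259 (bookkeeping)] -/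
theorem mem_truncLocus_iff_of_agreeOnSet {Y : Set (Site P 0)} {f : Sect2.CPair P 𝔸 → ℂ} (hloc : ∀ φ ψ, Sect2.agreeOnSet Y φ ψ → f φ = f ψ) (c : ℝ)
    {φ ψ : Sect2.CPair P 𝔸} (h : Sect2.agreeOnSet Y φ ψ) : φ ∈ truncLocus c f ↔ ψ ∈ truncLocus c f := by
  rw [mem_truncLocus_iff, mem_truncLocus_iff, analyticAt_iff_of_agreeOnSet hloc h, hloc φ ψ h]

/-- **THE TRUNCATION KEEPS (2.27)(i)**: a `Y`-local function has a `Y`-local truncation. [cite: Balaban1988Convergent, (2.27)(i) p.259] -/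
theorem truncC_congr_of_agreeOnSet {Y : Set (Site P 0)} {f : Sect2.CPair P 𝔸 → ℂ} (hloc : ∀ φ ψ, Sect2.agreeOnSet Y φ ψ → f φ = f ψ) (c : ℝ)
    {φ ψ : Sect2.CPair P 𝔸} (h : Sect2.agreeOnSet Y φ ψ) : truncC c f φ = truncC c f ψ := by
  by_cases hφ : φ ∈ truncLocus c f
  · rw [truncC_of_mem hφ, truncC_of_mem ((mem_truncLocus_iff_of_agreeOnSet hloc c h).1 hφ), hloc φ ψ h]
  · rw [truncC_of_not_mem hφ, truncC_of_not_mem (fun hψ => hφ ((mem_truncLocus_iff_of_agreeOnSet hloc c h).2 hψ))]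

end Glue

/-! ## §3  Gauge invariance ((2.27)(iii)) passes to the analyticity locus -/

section Gauge

variable {P : Params} {𝔸 : Type*} [NormedRing 𝔸]

/-- **(1.10) IS UNDONE BY THE INVERSE TRANSFORMATION**: `(φ^u)^{u⁻¹} = φ`. [cite: Balaban1987RG1, (1.10) p.262] -/
theorem cAct_inv_cAct (u : Site P 0 → 𝔸ˣ) (φ : Sect2.CPair P 𝔸) : Sect2.cAct u⁻¹ (Sect2.cAct u φ) = φ := by
  refine Prod.ext (funext fun b => ?_) (funext fun b => ?_)
  · show ((u⁻¹ b.src : 𝔸ˣ) : 𝔸) * (((u b.src : 𝔸ˣ) : 𝔸) * φ.1 b * ((u b.tgt)⁻¹ : 𝔸ˣ)) * (((u⁻¹ b.tgt)⁻¹ : 𝔸ˣ) : 𝔸) = φ.1 b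
    rw [Pi.inv_apply, Pi.inv_apply, inv_inv, ← mul_assoc, ← mul_assoc, Units.inv_mul, one_mul, mul_assoc, Units.inv_mul, mul_one]
  · show ((u⁻¹ b.src : 𝔸ˣ) : 𝔸) * (((u b.src : 𝔸ˣ) : 𝔸) * φ.2 b * ((u b.src)⁻¹ : 𝔸ˣ)) * (((u⁻¹ b.src)⁻¹ : 𝔸ˣ) : 𝔸) = φ.2 b
    rw [Pi.inv_apply, inv_inv, ← mul_assoc, ← mul_assoc, Units.inv_mul, one_mul, mul_assoc, Units.inv_mul, mul_one]

/-- `(φ^{u⁻¹})^{u} = φ`. [cite: Balaban1987RG1, (1.10) p.262] -/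
theorem cAct_cAct_inv (u : Site P 0 → 𝔸ˣ) (φ : Sect2.CPair P 𝔸) : Sect2.cAct u (Sect2.cAct u⁻¹ φ) = φ := by
  simpa only [inv_inv] using cAct_inv_cAct u⁻¹ φ

/-- The inverse of a subgroup-valued gauge transformation, read in `𝔸ˣ`, is the pointwise inverse. [cite: Balaban1987RG1, (1.10) p.262 (bookkeeping)] -/
theorem coe_inv_gauge {Gc : Subgroup 𝔸ˣ} (u : Site P 0 → Gc) : (fun x => ((u⁻¹ x : Gc) : 𝔸ˣ)) = (fun x => (u x : 𝔸ˣ))⁻¹ := by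
  funext x; rfl

variable [NormedAlgebra ℂ 𝔸]

/-- **(1.10) IS ANALYTIC** (coordinatewise `φ ↦ a · φ(b) · a′` in the normed algebra). [cite: Balaban1987RG1, (1.10) p.262] -/
theorem analyticAt_cAct (u : Site P 0 → 𝔸ˣ) (φ₀ : Sect2.CPair P 𝔸) : AnalyticAt ℂ (Sect2.cAct u) φ₀ := by
  refine AnalyticAt.prod (analyticAt_pi_iff.mpr fun b => ?_) (analyticAt_pi_iff.mpr fun b => ?_)
  · show AnalyticAt ℂ (fun φ : Sect2.CPair P 𝔸 => ((u b.src : 𝔸ˣ) : 𝔸) * φ.1 b * ((u b.tgt)⁻¹ : 𝔸ˣ)) φ₀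
    exact (analyticAt_const.mul (analyticAt_fst_apply b φ₀)).mul analyticAt_const
  · show AnalyticAt ℂ (fun φ : Sect2.CPair P 𝔸 => ((u b.src : 𝔸ˣ) : 𝔸) * φ.2 b * ((u b.src)⁻¹ : 𝔸ˣ)) φ₀
    exact (analyticAt_const.mul (analyticAt_snd_apply b φ₀)).mul analyticAt_const

/-- One direction: invariance under `u` moves analyticity from `φ^u` to `φ`. [cite: Balaban1988Convergent, (2.27)(iii) p.259 (bookkeeping)] -/
theorem analyticAt_of_analyticAt_cAct {f : Sect2.CPair P 𝔸 → ℂ} {u : Site P 0 → 𝔸ˣ} (hu : ∀ ψ, f (Sect2.cAct u ψ) = f ψ) {φ : Sect2.CPair P 𝔸}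
    (h : AnalyticAt ℂ f (Sect2.cAct u φ)) : AnalyticAt ℂ f φ := by
  have h1 : AnalyticAt ℂ (f ∘ Sect2.cAct u) φ := h.comp (analyticAt_cAct u φ)
  rwa [show f ∘ Sect2.cAct u = f from funext hu] at h1

/-- **★ A GAUGE-INVARIANT FUNCTION HAS A GAUGE-INVARIANT ANALYTICITY LOCUS**: if `f(φ^u) = f(φ)` and `f(φ^{u⁻¹}) = f(φ)` for all `φ` ((2.27)(iii) on a
group of transformations), then `AnalyticAt ℂ f φ^u ↔ AnalyticAt ℂ f φ`. [cite: Balaban1988Convergent, (2.27)(iii) p.259; Balaban1987RG1, (1.10) p.262] -/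
theorem analyticAt_cAct_iff_of_invariant {f : Sect2.CPair P 𝔸 → ℂ} {u : Site P 0 → 𝔸ˣ} (hu : ∀ ψ, f (Sect2.cAct u ψ) = f ψ)
    (hu' : ∀ ψ, f (Sect2.cAct u⁻¹ ψ) = f ψ) (φ : Sect2.CPair P 𝔸) : AnalyticAt ℂ f (Sect2.cAct u φ) ↔ AnalyticAt ℂ f φ := by
  refine ⟨analyticAt_of_analyticAt_cAct hu, fun h => ?_⟩
  have h1 : AnalyticAt ℂ f (Sect2.cAct u⁻¹ (Sect2.cAct u φ)) := by rw [cAct_inv_cAct]; exact h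
  exact analyticAt_of_analyticAt_cAct hu' h1

/-- **THE TRUNCATION KEEPS (2.27)(iii)**. [cite: Balaban1988Convergent, (2.27)(iii) p.259] -/
theorem truncC_cAct_of_invariant {f : Sect2.CPair P 𝔸 → ℂ} {u : Site P 0 → 𝔸ˣ} (hu : ∀ ψ, f (Sect2.cAct u ψ) = f ψ)
    (hu' : ∀ ψ, f (Sect2.cAct u⁻¹ ψ) = f ψ) (c : ℝ) (φ : Sect2.CPair P 𝔸) : truncC c f (Sect2.cAct u φ) = truncC c f φ := by
  have hl : Sect2.cAct u φ ∈ truncLocus c f ↔ φ ∈ truncLocus c f := by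
    rw [mem_truncLocus_iff, mem_truncLocus_iff, analyticAt_cAct_iff_of_invariant hu hu', hu φ]
  by_cases hφ : φ ∈ truncLocus c f
  · rw [truncC_of_mem hφ, truncC_of_mem (hl.2 hφ), hu φ]
  · rw [truncC_of_not_mem hφ, truncC_of_not_mem (fun h => hφ (hl.1 h))]

end Gauge

/-! ## §4  The record's embedding `U ↦ (ιU, 0)` into `Φ = (𝔸^{bonds})²`, `𝔸 = M_N(ℂ)`, is continuous -/

section Record

variable {P : Params} {N : ℕ}

/-- **THE RECORD'S BACKGROUND EMBEDDING IS CONTINUOUS**: `U ↦ Sect2.ofBackgroundC (ιSU N) U = ((U(b))_b, 0)` from `SU(N)`-valued configurations (product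
topology) into `Φ`. [cite: Balaban1987RG1, pp.251–252, (1.9) p.262 (bookkeeping)] -/
theorem continuous_ofBackgroundC_ιSU : Continuous fun U : GaugeField P 0 (SU N) => Sect2.ofBackgroundC (P := P) (ιSU N) U := by
  refine Continuous.prodMk (continuous_pi fun b => ?_) continuous_const
  show Continuous fun U : GaugeField P 0 (SU N) => ((ιSU N (U b) : (MatA N)ˣ) : MatA N)
  simp only [coe_ιSU]
  exact continuous_subtype_val.comp (continuous_apply b)

end Record

end Summit.QuantumFields.YangMills.Theorems.BalabanUVNodesN11OpenLocusTruncationDefs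

end
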